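import Summits.ResolutionOfSingularities.ResolutionOfSingularities.Theorems.FrobeniusLadderFInjectiveMacaulayficationF108ToricCones

/-!
# [OURS · L1 W4.5a · F-108 toric infrastructure 8/9] From `ℤ`-vectors to exponents and monomial changes of variables

Conversions used by the final assembly of `F108Consumable`: `toN` (a nonnegative `ℤ`-vector as an exponent `Fin n →₀ ℕ`),
`natMat` (the chart matrix of a decorated cone as an `ℕ`-matrix) with their cast lemmas; the monomial change of variables
`X_j ↦ ∏_i X_i ^ V i j` on monomials (`aeval_monomial_natMat`: `x^e ↦ x^{V e}`); products of monomials over a finite set; the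
product formula `(x^{e_j + κ} : j, κ) = (X_j : j) · (x^κ : κ)` for spans.  Elementary `MvPolynomial` bookkeeping only.
AI-written; weaker than expert review. Nothing here proves resolution of singularities in positive characteristic.
-/

set_option linter.dupNamespace false

noncomputable section

namespace Summit.ResolutionOfSingularities.ResolutionOfSingularities.Theorems.FInjectiveMacaulayfication.F108Toric

open Matrix Finset MvPolynomial

variable {n : ℕ}

open MvPolynomial

/-! ## Exponents -/

/-- The exponent of a nonnegative `ℤ`-vector. [OURS · bookkeeping] -/
def toN (x : Fin n → ℤ) : Fin n →₀ ℕ := Finsupp.equivFunOnFinite.symm fun j => (x j).toNat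

/-- Coordinates of `toN`. -/
@[simp] theorem toN_apply (x : Fin n → ℤ) (j : Fin n) : toN x j = (x j).toNat := by simp [toN]

/-- `toN` casts back to a nonnegative vector. -/
theorem cast_toN {x : Fin n → ℤ} (hx : ∀ j, 0 ≤ x j) (j : Fin n) : ((toN x j : ℕ) : ℤ) = x j := by
  rw [toN_apply, Int.toNat_of_nonneg (hx j)]

/-- `toN` as a function casts back to the vector. -/
theorem cast_comp_toN {x : Fin n → ℤ} (hx : ∀ j, 0 ≤ x j) : (fun j => ((toN x j : ℕ) : ℤ)) = x :=
  funext fun j => cast_toN hx j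

/-- `toN` is additive on nonnegative vectors. -/
theorem toN_add {x y : Fin n → ℤ} (hx : ∀ j, 0 ≤ x j) (hy : ∀ j, 0 ≤ y j) : toN (x + y) = toN x + toN y := by
  ext j; simp only [toN_apply, Pi.add_apply, Finsupp.coe_add]; exact Int.toNat_add (hx j) (hy j)

/-- `toN` is injective on nonnegative vectors. -/
theorem toN_inj {x y : Fin n → ℤ} (hx : ∀ j, 0 ≤ x j) (hy : ∀ j, 0 ≤ y j) (h : toN x = toN y) : x = y := by
  funext j; rw [← cast_toN hx j, ← cast_toN hy j, h]

/-- `toN e_j = single j 1`. -/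
theorem toN_single (j : Fin n) : toN (Pi.single j 1 : Fin n → ℤ) = Finsupp.single j 1 := by
  ext i; rw [toN_apply, Finsupp.single_apply, Pi.single_apply]
  by_cases h : i = j
  · subst h; simp
  · rw [if_neg h, if_neg (Ne.symm h)]; rfl

/-- `toN (c • e_j) = single j c.toNat`. -/
theorem toN_smul_single (c : ℤ) (j : Fin n) : toN (c • (Pi.single j 1 : Fin n → ℤ)) = Finsupp.single j c.toNat := by
  ext i; rw [toN_apply, Finsupp.single_apply, Pi.smul_apply, Pi.single_apply]
  by_cases h : i = j
  · subst h; simp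
  · rw [if_neg h, if_neg (Ne.symm h)]; simp

/-- The image in `ℤⁿ` of an exponent. [OURS · bookkeeping] -/
def ofN (e : Fin n →₀ ℕ) : Fin n → ℤ := fun j => (e j : ℤ)

/-- `ofN` is nonnegative. -/
theorem ofN_nonneg (e : Fin n →₀ ℕ) (j : Fin n) : 0 ≤ ofN e j := Int.natCast_nonneg _

/-- `toN ∘ ofN = id`. -/
theorem toN_ofN (e : Fin n →₀ ℕ) : toN (ofN e) = e := by ext j; simp [ofN]

/-! ## Chart matrices -/

/-- The chart matrix of a decorated cone as an `ℕ`-matrix (rows = rays). [OURS · bookkeeping] -/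
def natMat (d : DCone n) : Matrix (Fin n) (Fin n) ℕ := fun i j => (d.ray i j).toNat

/-- For nonnegative rays, `natMat` casts back to the ray matrix. -/
theorem natMat_map_cast {d : DCone n} (hd : ∀ i j, 0 ≤ d.ray i j) : (natMat d).map (Nat.cast : ℕ → ℤ) = Matrix.of d.ray := by
  ext i j; simp [natMat, Int.toNat_of_nonneg (hd i j)]

/-- `V *ᵥ e` casts to `⟨ray_i, e⟩`. -/
theorem cast_natMat_mulVec {d : DCone n} (hd : ∀ i j, 0 ≤ d.ray i j) (e : Fin n → ℕ) (i : Fin n) :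
    (((natMat d) *ᵥ e) i : ℤ) = d.ray i ⬝ᵥ fun j => (e j : ℤ) := by
  simp only [mulVec, dotProduct, natMat, Nat.cast_sum, Nat.cast_mul]
  exact sum_congr rfl fun j _ => by rw [Int.toNat_of_nonneg (hd i j)]

/-- `V *ᵥ e` casts to `⟨ray_i, ofN e⟩` for an exponent `e`. -/
theorem cast_natMat_mulVec_ofN {d : DCone n} (hd : ∀ i j, 0 ≤ d.ray i j) (e : Fin n →₀ ℕ) (i : Fin n) :
    (((natMat d) *ᵥ ⇑e) i : ℤ) = d.ray i ⬝ᵥ ofN e :=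
  cast_natMat_mulVec hd (⇑e) i

/-- `V *ᵥ (toN x)` casts to `⟨ray_i, x⟩` for `x ≥ 0`. -/
theorem cast_natMat_mulVec_toN {d : DCone n} (hd : ∀ i j, 0 ≤ d.ray i j) {x : Fin n → ℤ} (hx : ∀ j, 0 ≤ x j) (i : Fin n) :
    (((natMat d) *ᵥ ⇑(toN x)) i : ℤ) = d.ray i ⬝ᵥ x := by
  rw [cast_natMat_mulVec hd, cast_comp_toN hx]


/-- `toN` of a natural multiple of a nonnegative vector. -/
theorem toN_natCast_smul {x : Fin n → ℤ} (hx : ∀ j, 0 ≤ x j) (c : ℕ) : toN ((c : ℤ) • x) = c • toN x := by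
  ext j
  simp only [toN_apply, Pi.smul_apply, smul_eq_mul, Finsupp.coe_smul, Pi.smul_apply]
  have h := hx j
  have : ((c : ℤ) * x j).toNat = c * (x j).toNat := by
    have h2 : (((c : ℤ) * x j).toNat : ℤ) = ((c * (x j).toNat : ℕ) : ℤ) := by
      push_cast
      rw [Int.toNat_of_nonneg (mul_nonneg (Int.natCast_nonneg c) h), Int.toNat_of_nonneg h]
    exact_mod_cast h2
  rw [this]

/-- `toN` of a finite sum of nonnegative vectors. -/
theorem toN_sum {ι : Type*} (s : Finset ι) {v : ι → Fin n → ℤ} (hv : ∀ x ∈ s, ∀ j, 0 ≤ v x j) :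
    toN (∑ x ∈ s, v x) = ∑ x ∈ s, toN (v x) := by
  classical
  induction s using Finset.induction_on with
  | empty => ext j; simp [toN_apply]
  | insert a s ha ih =>
    rw [sum_insert ha, sum_insert ha, toN_add (hv a (mem_insert_self a s)) (fun j => ?_),
      ih fun x hx => hv x (mem_insert_of_mem hx)]
    rw [Finset.sum_apply]; exact sum_nonneg fun x hx => hv x (mem_insert_of_mem hx) j

/-- The chart matrix of a cone with a dual basis acts injectively on vectors. -/
theorem Inv.mulVec_injective {S : Finset (DCone n)} (hS : Inv S) {d : DCone n} (hd : d ∈ S) :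
    Function.Injective (Matrix.of d.ray).mulVec := by
  intro x y hxy
  have h : (Matrix.of d.w)ᵀ * Matrix.of d.ray = 1 := mul_eq_one_comm.1 (hS.ray_mul_w_transpose hd)
  have hx : ((Matrix.of d.w)ᵀ * Matrix.of d.ray) *ᵥ x = ((Matrix.of d.w)ᵀ * Matrix.of d.ray) *ᵥ y := by
    rw [← mulVec_mulVec, ← mulVec_mulVec, hxy]
  rwa [h, one_mulVec, one_mulVec] at hx

/-! ## Monomial changes of variables -/

variable {k : Type} [Field k]

/-- The monomial change of variables `X_j ↦ ∏_i X_i ^ V i j` sends `x^e` to `x^{V e}`. [folklore] -/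
theorem aeval_monomial_natMat (V : Matrix (Fin n) (Fin n) ℕ) (e : Fin n →₀ ℕ) (r : k) :
    aeval (fun j : Fin n => ∏ i : Fin n, (X i : MvPolynomial (Fin n) k) ^ V i j) (monomial e r) =
      monomial (Finsupp.equivFunOnFinite.symm (V *ᵥ ⇑e)) r := by
  rw [aeval_monomial, Finsupp.prod_fintype _ _ (fun j => by simp), monomial_eq, Finsupp.prod_fintype _ _ (fun j => by simp)]
  congr 1
  simp_rw [← prod_pow, ← pow_mul]
  rw [prod_comm]
  refine prod_congr rfl fun i _ => ?_
  rw [prod_pow_eq_pow_sum]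
  congr 1

/-- A product of monomials with coefficient `1` over a finite set. [folklore] -/
theorem prod_monomial_one {ι : Type*} (s : Finset ι) (v : ι → Fin n →₀ ℕ) :
    ∏ x ∈ s, (monomial (v x) (1 : k) : MvPolynomial (Fin n) k) = monomial (∑ x ∈ s, v x) 1 := by
  classical
  induction s using Finset.induction_on with
  | empty => simp
  | insert a s ha ih => rw [prod_insert ha, sum_insert ha, ih, monomial_mul, one_mul]

/-- The constant coefficient of a monomial. [folklore] -/
theorem constantCoeff_monomial' (d : Fin n →₀ ℕ) (a : k) :
    constantCoeff (monomial d a : MvPolynomial (Fin n) k) = if d = 0 then a else 0 := by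
  rw [constantCoeff_monomial]

/-- `x^{e_j + κ} = X_j · x^κ`. [folklore] -/
theorem monomial_single_add (j : Fin n) (κ : Fin n →₀ ℕ) :
    (monomial (Finsupp.single j 1 + κ) (1 : k) : MvPolynomial (Fin n) k) = X j * monomial κ 1 := by
  rw [X, monomial_mul, one_mul]

/-- THE PRODUCT FORMULA FOR SPANS: for a set `K` of exponents, the monomials `x^{e_j + κ}` (`j` any, `κ ∈ K`) span the product of the
ideal of the variables with the span of the monomials `x^κ`. [folklore] -/
theorem span_image_single_add (K : Set (Fin n →₀ ℕ)) :
    Ideal.span ((fun e : Fin n →₀ ℕ => (monomial e (1 : k) : MvPolynomial (Fin n) k)) ''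
        {e | ∃ j, ∃ κ ∈ K, e = Finsupp.single j 1 + κ}) =
      Ideal.span (Set.range fun j : Fin n => (X j : MvPolynomial (Fin n) k)) *
        Ideal.span ((fun e : Fin n →₀ ℕ => (monomial e (1 : k) : MvPolynomial (Fin n) k)) '' K) := by
  rw [Ideal.span_mul_span']
  congr 1
  ext p
  simp only [Set.mem_image, Set.mem_setOf_eq, Set.mem_mul, Set.mem_range]
  constructor
  · rintro ⟨e, ⟨j, κ, hκ, rfl⟩, rfl⟩
    exact ⟨X j, ⟨j, rfl⟩, monomial κ 1, ⟨κ, hκ, rfl⟩, (monomial_single_add j κ).symm⟩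
  · rintro ⟨_, ⟨j, rfl⟩, _, ⟨κ, hκ, rfl⟩, rfl⟩
    exact ⟨_, ⟨j, κ, hκ, rfl⟩, monomial_single_add j κ⟩

end Summit.ResolutionOfSingularities.ResolutionOfSingularities.Theorems.FInjectiveMacaulayfication.F108Toric

end
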